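import Mathlib.Analysis.SpecialFunctions.Pow.Asymptotics
import Summits.NavierStokesRegularity.FluidComputer.ModulatedCollapseGaugeRigidity
import Summits.NavierStokesRegularity.FluidComputer.SelfSimilarCollapseViscousRigidity
import HarnessLib

/-!
# The log-corrected Leray clock `λ_β(t) = (T−t)^{-1/2} (−log(T−t))^β`: positivity, smoothness,
# blow-up at `T` for EVERY real `β`, and non-constancy of its modulation `(T−t)λ_β² = (−log(T−t))^{2β}`

Summit `NavierStokesRegularity`, cell topic directory `FluidComputer`, namespace
`…FluidComputer.SelfSimilarCensus`; worked instance for `ModulatedCollapseGaugeRigidity.lean` (the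
exact one-profile modulated collapse `u = λ(t)U(λ(t)x)` solving the Navier–Stokes/Euler momentum
equation and blowing up at `T` has `(T − t)λ(t)² ≡ const` or `U ≡ 0`). Zone Z7 of the D-0081 profile
search names the gauge «generalised self-similar with LOGARITHMIC correction to the parabolic gauge»;
this file verifies, for the clock `λ_β(t) := (T−t)^{-1/2} (−log(T−t))^β` on the last unit of time
`t ∈ (T−1, T)` and every real `β`, the three hypotheses of that rigidity theorem — `λ_β > 0`
(`logClock_pos`), differentiability (`hasDerivAt_logClock`), blow-up `λ_β(t) → +∞` as `t ↑ T`
(`tendsto_logClock_atTop`, via the `0 · ∞` limit `x (−log x)^q → 0` as `x ↓ 0` for every real `q`,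
`tendsto_mul_negLog_rpow_nhdsGT_zero`; `T − t ↓ 0` is the tree's `tendsto_sub_self_nhdsLT_nhdsGT`) — and computes its modulation `(T−t)λ_β(t)² = (−log(T−t))^{2β}`
(`sub_mul_logClock_sq`), which takes the values `1` at `t = T − e⁻¹` and `2^{2β} ≠ 1` at `t = T − e⁻²`
when `β ≠ 0` (`logModulation_ne`): the log-corrected clock is NOT of the form `(2a(T−t))^{-1/2}`, so by
`sub_mul_sq_eq_const` NO exact one-profile collapse in this gauge with `U ≢ 0` solves the momentum
equation, for any `ν`, any pressure profile, any symmetry class (`eq_zero_of_momentum_logClock`).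
PROVED theorems only (elementary real analysis + one composition); no definitions, no named facts.

WHAT THIS IS NOT: not NS — calculus of one explicit scalar function; nothing about profiles,
Navier–Stokes dynamics, or the existence of any blow-up; «violates: none — no object».

Mathlib tools: `tendsto_log_mul_rpow_nhdsGT_zero`, `tendsto_rpow_neg_nhdsGT_zero`,
`Real.continuousAt_rpow_const`, `Real.rpow_le_rpow_of_exponent_le`, `Real.mul_rpow`, `Real.rpow_mul`,
`HasDerivAt.rpow_const`, `Real.hasDerivAt_log`.

References: J. Leray, Acta Math. 63 (1934), (3.12) (the clock with `β = 0`). [Leray1934]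
-/

noncomputable section

open Set Filter Topology InnerProductSpace
open scoped Laplacian RealInnerProductSpace

namespace Summit.NavierStokesRegularity.FluidComputer.SelfSimilarCensus

open Literature.Analysis.FluidPDE

/-! ### §1 The `0 · ∞` limit `x (−log x)^q → 0` as `x ↓ 0`, for every real `q` -/

/-- For `0 < x ≤ e⁻¹` one has `1 ≤ −log x`. [folklore] -/
theorem one_le_negLog {x : ℝ} (h0 : 0 < x) (h1 : x ≤ Real.exp (-1)) : 1 ≤ -Real.log x := by
  have := Real.log_le_log h0 h1
  rw [Real.log_exp] at this
  linarith

/-- **`x (−log x)^q → 0` as `x ↓ 0`, for EVERY real exponent `q`.** For `q′ := max q 1 > 0`: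
`x (−log x)^{q′} = (−(log x · x^{1/q′}))^{q′} → 0` by Mathlib's `log x · x^r → 0` (`r = 1/q′`) and the
continuity of `y ↦ y^{q′}` at `0`; for `x ≤ e⁻¹` one has `−log x ≥ 1`, so
`0 ≤ x (−log x)^q ≤ x (−log x)^{q′}` (the positive-exponent case is also the tree's
`Balaban1983to89.T3ThresholdSmallness.tendsto_mul_neg_log_rpow_nhdsGT_zero`, not imported here). [folklore] -/
theorem tendsto_mul_negLog_rpow_nhdsGT_zero (q : ℝ) :
    Tendsto (fun x : ℝ => x * (-Real.log x) ^ q) (𝓝[>] 0) (𝓝 0) := by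
  have hq' : 0 < max q 1 := lt_of_lt_of_le one_pos (le_max_right q 1)
  -- the positive exponent `q' = max q 1`
  have hup : Tendsto (fun x : ℝ => x * (-Real.log x) ^ max q 1) (𝓝[>] 0) (𝓝 0) := by
    have h1 : Tendsto (fun x : ℝ => -(Real.log x * x ^ (1 / max q 1))) (𝓝[>] 0) (𝓝 0) := by
      simpa using (tendsto_log_mul_rpow_nhdsGT_zero (r := 1 / max q 1) (by positivity)).neg
    have h2 : Tendsto (fun y : ℝ => y ^ max q 1) (𝓝 0) (𝓝 0) := by
      have hc := (Real.continuousAt_rpow_const 0 (max q 1) (Or.inr hq'.le)).tendsto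
      rwa [Real.zero_rpow hq'.ne'] at hc
    refine (h2.comp h1).congr' ?_
    filter_upwards [Ioo_mem_nhdsGT (show (0 : ℝ) < 1 from one_pos)] with x hx
    have hx0 : 0 ≤ x := hx.1.le
    have hl : 0 ≤ -Real.log x := (neg_pos.2 (Real.log_neg hx.1 hx.2)).le
    show (-(Real.log x * x ^ (1 / max q 1))) ^ max q 1 = x * (-Real.log x) ^ max q 1
    rw [show -(Real.log x * x ^ (1 / max q 1)) = x ^ (1 / max q 1) * (-Real.log x) by ring,
      Real.mul_rpow (Real.rpow_nonneg hx0 _) hl, ← Real.rpow_mul hx0, one_div_mul_cancel hq'.ne',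
      Real.rpow_one]
  -- squeeze
  have hmem : Ioo (0 : ℝ) (Real.exp (-1)) ∈ 𝓝[>] (0 : ℝ) := Ioo_mem_nhdsGT (Real.exp_pos _)
  refine tendsto_of_tendsto_of_tendsto_of_le_of_le' tendsto_const_nhds hup ?_ ?_
  · filter_upwards [hmem] with x hx
    exact mul_nonneg hx.1.le (Real.rpow_nonneg (neg_pos.2 (Real.log_neg hx.1 (hx.2.trans
      (Real.exp_lt_one_iff.2 (by norm_num))))).le _)
  · filter_upwards [hmem] with x hx
    exact mul_le_mul_of_nonneg_left
      (Real.rpow_le_rpow_of_exponent_le (one_le_negLog hx.1 hx.2.le) (le_max_left q 1)) hx.1.le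

/-! ### §2 The clock `λ_β(t) = (T−t)^{-1/2} (−log(T−t))^β` on `(T − 1, T)` -/

section LogClock

variable {T β : ℝ}

/-- On the last unit of time, `0 < T − t < 1`. [folklore] -/
theorem sub_mem_Ioo_of_mem_Ioo {t : ℝ} (ht : t ∈ Ioo (T - 1) T) : T - t ∈ Ioo (0 : ℝ) 1 :=
  ⟨by linarith [ht.2], by linarith [ht.1]⟩

/-- **Positivity**: `λ_β(t) > 0` for `t ∈ (T−1, T)`. [folklore] -/
theorem logClock_pos {t : ℝ} (ht : t ∈ Ioo (T - 1) T) :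
    0 < (T - t) ^ (-(1 / 2 : ℝ)) * (-Real.log (T - t)) ^ β := by
  obtain ⟨h0, h1⟩ := sub_mem_Ioo_of_mem_Ioo ht
  exact mul_pos (Real.rpow_pos_of_pos h0 _) (Real.rpow_pos_of_pos (neg_pos.2 (Real.log_neg h0 h1)) _)

/-- **Differentiability**: `λ_β` has a derivative at every `t ∈ (T−1, T)` (both bases `T − t` and
`−log(T−t)` are positive there). [folklore] -/
theorem hasDerivAt_logClock {t : ℝ} (ht : t ∈ Ioo (T - 1) T) :
    HasDerivAt (fun s => (T - s) ^ (-(1 / 2 : ℝ)) * (-Real.log (T - s)) ^ β)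
      (deriv (fun s => (T - s) ^ (-(1 / 2 : ℝ)) * (-Real.log (T - s)) ^ β) t) t := by
  obtain ⟨h0, h1⟩ := sub_mem_Ioo_of_mem_Ioo ht
  have hsub : HasDerivAt (fun s : ℝ => T - s) (-1) t := by
    simpa using (hasDerivAt_id t).const_sub T
  have hA := hsub.rpow_const (p := -(1 / 2 : ℝ)) (Or.inl h0.ne')
  have hlog := ((Real.hasDerivAt_log h0.ne').comp t hsub).neg
  have hB := hlog.rpow_const (p := β) (Or.inl (neg_pos.2 (Real.log_neg h0 h1)).ne')
  exact (hA.mul hB).differentiableAt.hasDerivAt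

/-- **The modulation of the log clock**: `(T − t) λ_β(t)² = (−log(T−t))^{2β}` on `(T−1, T)`. [folklore] -/
theorem sub_mul_logClock_sq {t : ℝ} (ht : t ∈ Ioo (T - 1) T) :
    (T - t) * ((T - t) ^ (-(1 / 2 : ℝ)) * (-Real.log (T - t)) ^ β) ^ 2 =
      (-Real.log (T - t)) ^ (2 * β) := by
  obtain ⟨h0, h1⟩ := sub_mem_Ioo_of_mem_Ioo ht
  have hl : 0 ≤ -Real.log (T - t) := (neg_pos.2 (Real.log_neg h0 h1)).le
  have e1 : ((T - t) ^ (-(1 / 2 : ℝ))) ^ 2 = (T - t)⁻¹ := by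
    rw [← Real.rpow_natCast, ← Real.rpow_mul h0.le]
    norm_num
    rw [Real.rpow_neg_one]
  have e2 : ((-Real.log (T - t)) ^ β) ^ 2 = (-Real.log (T - t)) ^ (2 * β) := by
    rw [← Real.rpow_natCast, ← Real.rpow_mul hl, mul_comm]
    norm_num
  rw [mul_pow, e1, e2, ← mul_assoc, mul_inv_cancel₀ h0.ne', one_mul]

/-- The two sample times `T − e⁻¹` and `T − e⁻²` lie in `(T−1, T)`. [folklore] -/
theorem sub_exp_neg_mem_Ioo (T : ℝ) {k : ℝ} (hk : 0 < k) : T - Real.exp (-k) ∈ Ioo (T - 1) T := by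
  have h1 : Real.exp (-k) < 1 := Real.exp_lt_one_iff.2 (by linarith)
  have h2 : 0 < Real.exp (-k) := Real.exp_pos _
  exact ⟨by linarith, by linarith⟩

/-- **The log modulation is not constant for `β ≠ 0`**: `(−log(T−t))^{2β}` equals `1` at
`t = T − e⁻¹` and `2^{2β} ≠ 1` at `t = T − e⁻²`. [folklore] -/
theorem logModulation_ne (hβ : β ≠ 0) :
    (-Real.log (T - (T - Real.exp (-1)))) ^ (2 * β) ≠
      (-Real.log (T - (T - Real.exp (-2)))) ^ (2 * β) := by
  rw [sub_sub_cancel, sub_sub_cancel, Real.log_exp, Real.log_exp, neg_neg, neg_neg, Real.one_rpow]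
  intro h
  rcases lt_or_gt_of_ne hβ with hb | hb
  · have : (2 : ℝ) ^ (2 * β) < 1 := Real.rpow_lt_one_of_one_lt_of_neg one_lt_two (by linarith)
    linarith
  · have : 1 < (2 : ℝ) ^ (2 * β) := Real.one_lt_rpow one_lt_two (by linarith)
    linarith

/-- The reciprocal squared clock `(T − t)(−log(T−t))^{−2β} = λ_β(t)⁻²` tends to `0⁺` as `t ↑ T`,
for EVERY real `β`. [folklore] -/
theorem tendsto_invSq_logClock (T β : ℝ) :
    Tendsto (fun t : ℝ => (T - t) * (-Real.log (T - t)) ^ (-2 * β)) (𝓝[<] T) (𝓝[>] 0) := by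
  refine tendsto_nhdsWithin_iff.2 ⟨?_, ?_⟩
  · exact (tendsto_mul_negLog_rpow_nhdsGT_zero (-2 * β)).comp (tendsto_sub_self_nhdsLT_nhdsGT T)
  · filter_upwards [Ioo_mem_nhdsLT (show T - 1 < T by linarith)] with t ht
    obtain ⟨h0, h1⟩ := sub_mem_Ioo_of_mem_Ioo ht
    exact mul_pos h0 (Real.rpow_pos_of_pos (neg_pos.2 (Real.log_neg h0 h1)) _)

/-- **Blow-up of the log clock at `T`, for EVERY real `β`**: `λ_β(t) → +∞` as `t ↑ T`
(`λ_β = (λ_β⁻²)^{-1/2}` with `λ_β⁻² = (T−t)(−log(T−t))^{−2β} ↓ 0`; for `β < 0` this is the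
`0 · ∞` limit of §1). [folklore] -/
theorem tendsto_logClock_atTop (T β : ℝ) :
    Tendsto (fun t : ℝ => (T - t) ^ (-(1 / 2 : ℝ)) * (-Real.log (T - t)) ^ β) (𝓝[<] T) atTop := by
  have h := (tendsto_rpow_neg_nhdsGT_zero (y := -(1 / 2 : ℝ)) (by norm_num)).comp
    (tendsto_invSq_logClock T β)
  refine h.congr' ?_
  filter_upwards [Ioo_mem_nhdsLT (show T - 1 < T by linarith)] with t ht
  obtain ⟨h0, h1⟩ := sub_mem_Ioo_of_mem_Ioo ht
  have hl : 0 ≤ -Real.log (T - t) := (neg_pos.2 (Real.log_neg h0 h1)).le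
  show ((T - t) * (-Real.log (T - t)) ^ (-2 * β)) ^ (-(1 / 2 : ℝ)) =
    (T - t) ^ (-(1 / 2 : ℝ)) * (-Real.log (T - t)) ^ β
  rw [Real.mul_rpow h0.le (Real.rpow_nonneg hl _), ← Real.rpow_mul hl]
  congr 2
  ring

end LogClock

/-! ### §3 No exact one-profile collapse in the log-corrected gauge -/

section NoLogCollapse

variable {E : Type*} [NormedAddCommGroup E] [InnerProductSpace ℝ E] [FiniteDimensional ℝ E]
variable {U : E → E} {T β ν : ℝ}

/-- **No exact one-profile collapse with a logarithmic correction.** Let `E` be a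
finite-dimensional real inner product space, `U ∈ C¹(E; E)`, `P : E → ℝ`, `ν : ℝ` (any sign, `0`
allowed), `β ≠ 0`, and `λ_β(t) = (T−t)^{-1/2} (−log(T−t))^β`. If
`u(t, x) = λ_β(t) • U(λ_β(t) • x)`, `p(t, x) = λ_β(t)² P(λ_β(t) • x)` satisfy the momentum equation
`∂ₜu + (u·∇)u + ∇p − νΔu = 0` at every point of `(T−1, T) × E`, then `U ≡ 0`: by
`sub_mul_sq_eq_const` the modulation `(T−t)λ_β² = (−log(T−t))^{2β}` would be constant on `(T−1, T)`,
but it reads `1` at `T − e⁻¹` and `2^{2β} ≠ 1` at `T − e⁻²` (`logModulation_ne`). The zone-Z7 gauge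
«parabolic with logarithmic correction» therefore carries NO exact one-profile (steady-in-similarity-
variables) object, in any symmetry class, viscous or inviscid; its content is in DRIFTING profiles
only. [folklore] -/
theorem eq_zero_of_momentum_logClock (hβ : β ≠ 0) (hU : ContDiff ℝ 1 U) (P : E → ℝ)
    (heq : ∀ t ∈ Ioo (T - 1) T, ∀ x : E,
      timeDeriv (fun s => nsRescaleData ((T - s) ^ (-(1 / 2 : ℝ)) * (-Real.log (T - s)) ^ β) U) t x +
          convect (nsRescaleData ((T - t) ^ (-(1 / 2 : ℝ)) * (-Real.log (T - t)) ^ β) U)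
            (nsRescaleData ((T - t) ^ (-(1 / 2 : ℝ)) * (-Real.log (T - t)) ^ β) U) x +
          gradient (fun y => ((T - t) ^ (-(1 / 2 : ℝ)) * (-Real.log (T - t)) ^ β) ^ 2 *
            P (((T - t) ^ (-(1 / 2 : ℝ)) * (-Real.log (T - t)) ^ β) • y)) x -
          ν • (Δ (nsRescaleData ((T - t) ^ (-(1 / 2 : ℝ)) * (-Real.log (T - t)) ^ β) U)) x = 0) :
    U = 0 := by
  by_contra hU0
  have hT : T - 1 < T := by linarith
  obtain ⟨a, -, h⟩ := sub_mul_sq_eq_const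
    (lam := fun s => (T - s) ^ (-(1 / 2 : ℝ)) * (-Real.log (T - s)) ^ β)
    (lam' := deriv fun s => (T - s) ^ (-(1 / 2 : ℝ)) * (-Real.log (T - s)) ^ β)
    hT (fun t ht => hasDerivAt_logClock ht) (fun t ht => logClock_pos ht)
    (tendsto_logClock_atTop T β) hU heq hU0
  have h1 := h _ (sub_exp_neg_mem_Ioo T one_pos)
  have h2 := h _ (sub_exp_neg_mem_Ioo T two_pos)
  rw [sub_mul_logClock_sq (sub_exp_neg_mem_Ioo T one_pos)] at h1
  rw [sub_mul_logClock_sq (sub_exp_neg_mem_Ioo T two_pos)] at h2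
  exact logModulation_ne hβ (h1.trans h2.symm)

end NoLogCollapse

end Summit.NavierStokesRegularity.FluidComputer.SelfSimilarCensus

end
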